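import Summits.Ventures.PercRepro.ProfilePointedCircuitClassesStarSharpDefectD

/-!
# PercRepro — (L0) THE DEFECTS OF `R` ARE AT MOST THREE, PART E: THE COUNT
(p5, gen 55; `proofs/P5-GM1.md` §82 ADD 5–6)

`card_d0Def_le_three`: the defects of `R` are at most three.  With the rank facts of part D the argument is
combinatorial: if two distinct B2 defects exist they share a vertex `a` (`{a, y}`, `{a, y′}`), a third B2 defect is
`{y, y′}` and then every defect meets all three edges of the triangle (so is one of them), otherwise every B1 defect
lies in `{a, y, y′}`; if at most one B2 defect exists, two B1 defects at a vertex `c` confine every B1 defect to the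
triangle on `c` and their other ends (the two outside points are `e`-collinear and no B1 endpoint is), and a B2 defect
meeting the whole triangle is one of its edges; otherwise the B1 defects are pairwise disjoint pairs of a 5-set, at
most two.
-/

open scoped Matroid

namespace PercRepro.Cogirth

open Finset ThmH Skew Shadow Profile

open Classical

variable {α : Type} [DecidableEq α] {N : Matroid α} [N.Finite]

section StarSharpDefectE

variable {b b' : α}

/-- A pair inside `{a, y} ∪ {a, y′}` is one of the three pairs of the triangle. -/
theorem pair_eq_of_subset_union_pair {σ : Finset α} (hσ2 : σ.card = 2) {a y y' : α}
    (hσ : σ ⊆ {a, y} ∪ {a, y'}) : σ = {a, y} ∨ σ = {a, y'} ∨ σ = {y, y'} := by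
  obtain ⟨p, q, hpq, rfl⟩ := card_eq_two.1 hσ2
  have hp := hσ (mem_insert_self _ _)
  have hq := hσ (mem_insert_of_mem (mem_singleton_self _))
  simp only [mem_union, mem_insert, mem_singleton, or_assoc] at hp hq
  rcases hp with rfl | rfl | rfl | rfl <;> rcases hq with rfl | rfl | rfl | rfl <;>
    first
    | exact absurd rfl hpq
    | exact Or.inl rfl
    | exact Or.inr (Or.inl rfl)
    | exact Or.inr (Or.inr rfl)
    | exact Or.inl (pair_comm' _ _)
    | exact Or.inr (Or.inl (pair_comm' _ _))
    | exact Or.inr (Or.inr (pair_comm' _ _))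

/-- A pair meeting the three edges of a triangle `a, y, y′` is one of them. -/
theorem pair_eq_of_meets_triangle {σ : Finset α} (hσ2 : σ.card = 2) {a y y' : α} (hay : a ≠ y) (hay' : a ≠ y')
    (hyy' : y ≠ y') (h1 : a ∈ σ ∨ y ∈ σ) (h2 : a ∈ σ ∨ y' ∈ σ) (h3 : y ∈ σ ∨ y' ∈ σ) :
    σ = {a, y} ∨ σ = {a, y'} ∨ σ = {y, y'} := by
  by_cases ha : a ∈ σ
  · rcases h3 with hy | hy'
    · exact Or.inl (eq_pair_of_card_two hσ2 ha hy hay)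
    · exact Or.inr (Or.inl (eq_pair_of_card_two hσ2 ha hy' hay'))
  · have hy : y ∈ σ := h1.resolve_left ha
    have hy' : y' ∈ σ := h2.resolve_left ha
    exact Or.inr (Or.inr (eq_pair_of_card_two hσ2 hy hy' hyy'))

/-- Pairwise disjoint pairs inside a 5-set: at most two. -/
theorem card_le_two_of_pairwise_disjoint_pairs {S : Finset (Finset α)} {X : Finset α} (hX5 : X.card = 5)
    (hS : ∀ π ∈ S, π ⊆ X ∧ π.card = 2) (hdis : ∀ π ∈ S, ∀ σ ∈ S, π ≠ σ → ∀ u ∈ π, u ∉ σ) : S.card ≤ 2 := by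
  have h1 : (S.biUnion id).card = ∑ π ∈ S, (id π).card := by
    apply card_biUnion
    intro π hπ σ hσ hne
    exact disjoint_left.2 (fun u hu hu' => hdis π hπ σ hσ hne u hu hu')
  have h2 : ∑ π ∈ S, (id π).card = ∑ _π ∈ S, 2 := by
    apply sum_congr rfl
    intro π hπ
    exact (hS π hπ).2
  rw [sum_const, smul_eq_mul] at h2
  have h3 : S.biUnion id ⊆ X := by
    intro u hu
    obtain ⟨π, hπ, huπ⟩ := mem_biUnion.1 hu
    exact (hS π hπ).1 huπ
  have h4 := card_le_card h3
  rw [hX5] at h4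
  omega

/-- **(A3)**: two distinct B1 defects through `c` confine every B1 defect to `σ₁ ∪ σ₂`. -/
theorem b1_subset_union_of_two_b1 (hn : (gr N).card = 9) (h : SeriesPair N b b') {e f : α} (he : e ∈ gr N)
    (hf : f ∈ gr N) (hef : e ≠ f) (heb : e ≠ b) (heb' : e ≠ b') (hfb : f ≠ b) (hfb' : f ≠ b')
    (he1 : ∀ y ∈ ((((gr N).erase b).erase b').erase f).erase e, rk N {e, y} = 2)
    (hfc : ∀ y ∈ ((((gr N).erase b).erase b').erase f).erase e, rk N (((((gr N).erase b).erase b').erase f).erase y) = 4)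
    {σ₁ σ₂ ρ : Finset α} (hσ₁ : σ₁ ∈ d0Def N b b' e f) (hσ₂ : σ₂ ∈ d0Def N b b' e f) (hne : σ₁ ≠ σ₂)
    (hB1 : rk N (insert e (((((gr N).erase b).erase b').erase f).erase e \ σ₁)) = 3)
    (hB2 : rk N (insert e (((((gr N).erase b).erase b').erase f).erase e \ σ₂)) = 3) {c : α} (hc1 : c ∈ σ₁)
    (hc2 : c ∈ σ₂) (hρ : ρ ∈ d0Def N b b' e f)
    (hρB1 : rk N (insert e (((((gr N).erase b).erase b').erase f).erase e \ ρ)) = 3) : ρ ⊆ σ₁ ∪ σ₂ := by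
  obtain ⟨h1X, h12, -, -, -⟩ := mem_d0Def.1 hσ₁
  obtain ⟨h2X, h22, -, -, -⟩ := mem_d0Def.1 hσ₂
  obtain ⟨hρX, hρ2, hρe, -, -⟩ := mem_d0Def.1 hρ
  have hX5 := card_X_eq_five hn h he hf hef heb heb' hfb hfb'
  have hU3 := card_union_eq_three_of_ne h12 h22 hc1 hc2 hne
  intro u hu
  by_contra huU
  have huX := hρX hu
  have hout : 1 < (((((gr N).erase b).erase b').erase f).erase e \ (σ₁ ∪ σ₂)).card := by
    rw [card_sdiff_of_subset (union_subset h1X h2X), hX5, hU3]; omega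
  obtain ⟨v, hv, hvu⟩ := exists_mem_ne hout u
  rw [mem_sdiff] at hv
  have h1 := rk_insert_e_pair_le_two_of_two_b1 he hef heb heb' hfc h1X h12 h2X h22 hne hB1 hB2 hc1 hc2 huX hv.1
    (fun h' => huU (mem_union_left _ h')) (fun h' => huU (mem_union_right _ h'))
    (fun h' => hv.2 (mem_union_left _ h')) (fun h' => hv.2 (mem_union_right _ h'))
  have h2 := rk_insert_e_pair_eq_three_of_b1 he hef heb heb' he1 hfc hρX hρ2 hρe hρB1 hu hv.1 hvu
  omega

/-- **(L0) — THE DEFECTS OF `R` ARE AT MOST THREE** (§82 ADD 5–6; census: never four on the 191,842 D0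
configurations). -/
theorem card_d0Def_le_three (hn : (gr N).card = 9) (h : SeriesPair N b b') {e f : α} (he : e ∈ gr N) (hf : f ∈ gr N)
    (hef : e ≠ f) (heb : e ≠ b) (heb' : e ≠ b') (hfb : f ≠ b) (hfb' : f ≠ b')
    (he1 : ∀ y ∈ ((((gr N).erase b).erase b').erase f).erase e, rk N {e, y} = 2)
    (hf1 : ∀ y ∈ ((((gr N).erase b).erase b').erase f).erase e, rk N {f, y} = 2)
    (hfc : ∀ y ∈ ((((gr N).erase b).erase b').erase f).erase e, rk N (((((gr N).erase b).erase b').erase f).erase y) = 4)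
    (hX : rk N (((((gr N).erase b).erase b').erase f).erase e) = 4) :
    (d0Def N b b' e f).card ≤ 3 := by
  have hX5 := card_X_eq_five hn h he hf hef heb heb' hfb hfb'
  have hor : ∀ π ∈ d0Def N b b' e f,
      rk N (insert e (((((gr N).erase b).erase b').erase f).erase e \ π)) = 3 ∨ rk N (insert f π) = 2 :=
    fun π hπ => b1_or_b2_of_mem_d0Def hn h he hf hef heb heb' hfb hfb' hπ
  have hmeet : ∀ π ∈ d0Def N b b' e f, rk N (insert f π) = 2 → ∀ σ ∈ d0Def N b b' e f, ∃ u ∈ π, u ∈ σ := by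
    intro π hπ hB2 σ hσ
    by_contra hno
    push Not at hno
    exact not_disjoint_of_b2 hn h he hf hef heb heb' hfb hfb' hπ hB2 hσ hno
  by_cases h2B2 : ∃ π₁ ∈ d0Def N b b' e f, ∃ π₂ ∈ d0Def N b b' e f, π₁ ≠ π₂ ∧
      rk N (insert f π₁) = 2 ∧ rk N (insert f π₂) = 2
  · obtain ⟨π₁, hπ₁, π₂, hπ₂, hne, hB1, hB2⟩ := h2B2
    have h12 := (mem_d0Def.1 hπ₁).2.1
    have h22 := (mem_d0Def.1 hπ₂).2.1
    obtain ⟨a, ha1, ha2⟩ := hmeet π₁ hπ₁ hB1 π₂ hπ₂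
    obtain ⟨y, hy1, hya⟩ := exists_mem_ne (by omega : 1 < π₁.card) a
    obtain ⟨y', hy'2, hy'a⟩ := exists_mem_ne (by omega : 1 < π₂.card) a
    have hπ₁eq : π₁ = {a, y} := eq_pair_of_card_two h12 ha1 hy1 hya.symm
    have hπ₂eq : π₂ = {a, y'} := eq_pair_of_card_two h22 ha2 hy'2 hy'a.symm
    have hyy' : y ≠ y' := fun h' => hne (by rw [hπ₁eq, hπ₂eq, h'])
    -- a defect meeting `π₁` contains `a` or `y`; meeting `π₂`: `a` or `y′`
    have hm1 : ∀ σ : Finset α, (∃ u ∈ π₁, u ∈ σ) → a ∈ σ ∨ y ∈ σ := by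
      rintro σ ⟨u, hu, huσ⟩
      rw [hπ₁eq] at hu
      simp only [mem_insert, mem_singleton] at hu
      rcases hu with rfl | rfl
      · exact Or.inl huσ
      · exact Or.inr huσ
    have hm2 : ∀ σ : Finset α, (∃ u ∈ π₂, u ∈ σ) → a ∈ σ ∨ y' ∈ σ := by
      rintro σ ⟨u, hu, huσ⟩
      rw [hπ₂eq] at hu
      simp only [mem_insert, mem_singleton] at hu
      rcases hu with rfl | rfl
      · exact Or.inl huσ
      · exact Or.inr huσ
    by_cases h3B2 : ∃ σ ∈ d0Def N b b' e f, σ ≠ π₁ ∧ σ ≠ π₂ ∧ rk N (insert f σ) = 2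
    · obtain ⟨σ, hσ, hσ1, hσ2, hσB2⟩ := h3B2
      have hσ2c := (mem_d0Def.1 hσ).2.1
      have haσ : a ∉ σ := fun haσ =>
        not_three_b2 hn h he hf hef heb heb' hfb hfb' hf1 hX hπ₁ hπ₂ hσ hne hσ1.symm hσ2.symm hB1 hB2 hσB2 ha1 ha2 haσ
      have hyσ : y ∈ σ := (hm1 σ (hmeet π₁ hπ₁ hB1 σ hσ)).resolve_left haσ
      have hy'σ : y' ∈ σ := (hm2 σ (hmeet π₂ hπ₂ hB2 σ hσ)).resolve_left haσ
      have hσeq : σ = {y, y'} := eq_pair_of_card_two hσ2c hyσ hy'σ hyy'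
      have hm3 : ∀ ρ : Finset α, (∃ u ∈ σ, u ∈ ρ) → y ∈ ρ ∨ y' ∈ ρ := by
        rintro ρ ⟨u, hu, huρ⟩
        rw [hσeq] at hu
        simp only [mem_insert, mem_singleton] at hu
        rcases hu with rfl | rfl
        · exact Or.inl huρ
        · exact Or.inr huρ
      have hsub : d0Def N b b' e f ⊆ {π₁, π₂, σ} := by
        intro ρ hρ
        have hρ2 := (mem_d0Def.1 hρ).2.1
        rcases pair_eq_of_meets_triangle hρ2 hya.symm hy'a.symm hyy' (hm1 ρ (hmeet π₁ hπ₁ hB1 ρ hρ))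
          (hm2 ρ (hmeet π₂ hπ₂ hB2 ρ hρ)) (hm3 ρ (hmeet σ hσ hσB2 ρ hρ)) with h' | h' | h'
        · rw [h', ← hπ₁eq]; exact mem_insert_self _ _
        · rw [h', ← hπ₂eq]; exact mem_insert_of_mem (mem_insert_self _ _)
        · rw [h', ← hσeq]; exact mem_insert_of_mem (mem_insert_of_mem (mem_singleton_self _))
      exact (card_le_card hsub).trans card_le_three
    · push Not at h3B2
      have hsub : d0Def N b b' e f ⊆ {π₁, π₂, {y, y'}} := by
        intro ρ hρ
        have hρ2 := (mem_d0Def.1 hρ).2.1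
        by_cases hρ1 : ρ = π₁
        · rw [hρ1]; exact mem_insert_self _ _
        by_cases hρ2' : ρ = π₂
        · rw [hρ2']; exact mem_insert_of_mem (mem_insert_self _ _)
        have hρB1 := (hor ρ hρ).resolve_right (h3B2 ρ hρ hρ1 hρ2')
        have hρU := b1_subset_union_of_two_b2 hn h he hf hef heb heb' hfb hfb' hf1 hfc hπ₁ hπ₂ hne hB1 hB2 ha1 ha2
          hρ hρB1
        rw [hπ₁eq, hπ₂eq] at hρU
        rcases pair_eq_of_subset_union_pair hρ2 hρU with h' | h' | h'
        · exact absurd (h'.trans hπ₁eq.symm) hρ1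
        · exact absurd (h'.trans hπ₂eq.symm) hρ2'
        · rw [h']; exact mem_insert_of_mem (mem_insert_of_mem (mem_singleton_self _))
      exact (card_le_card hsub).trans card_le_three
  · push Not at h2B2
    -- at most one B2 defect
    have hB2one : ∀ π ∈ d0Def N b b' e f, rk N (insert f π) = 2 → ∀ σ ∈ d0Def N b b' e f,
        rk N (insert f σ) = 2 → σ = π := by
      intro π hπ hπB2 σ hσ hσB2
      by_contra hne
      exact h2B2 π hπ σ hσ (Ne.symm hne) hπB2 hσB2
    by_cases h2B1 : ∃ c, ∃ σ₁ ∈ d0Def N b b' e f, ∃ σ₂ ∈ d0Def N b b' e f, σ₁ ≠ σ₂ ∧ c ∈ σ₁ ∧ c ∈ σ₂ ∧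
        rk N (insert e (((((gr N).erase b).erase b').erase f).erase e \ σ₁)) = 3 ∧
        rk N (insert e (((((gr N).erase b).erase b').erase f).erase e \ σ₂)) = 3
    · obtain ⟨c, σ₁, hσ₁, σ₂, hσ₂, hne, hc1, hc2, hB1, hB2⟩ := h2B1
      have h12 := (mem_d0Def.1 hσ₁).2.1
      have h22 := (mem_d0Def.1 hσ₂).2.1
      obtain ⟨x, hx1, hxc⟩ := exists_mem_ne (by omega : 1 < σ₁.card) c
      obtain ⟨x', hx'2, hx'c⟩ := exists_mem_ne (by omega : 1 < σ₂.card) c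
      have hσ₁eq : σ₁ = {c, x} := eq_pair_of_card_two h12 hc1 hx1 hxc.symm
      have hσ₂eq : σ₂ = {c, x'} := eq_pair_of_card_two h22 hc2 hx'2 hx'c.symm
      have hxx' : x ≠ x' := fun h' => hne (by rw [hσ₁eq, hσ₂eq, h'])
      -- every B1 defect is an edge of the triangle `c, x, x′`
      have htri : ∀ ρ ∈ d0Def N b b' e f, rk N (insert e (((((gr N).erase b).erase b').erase f).erase e \ ρ)) = 3 →
          ρ = σ₁ ∨ ρ = σ₂ ∨ ρ = {x, x'} := by
        intro ρ hρ hρB1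
        have hρ2 := (mem_d0Def.1 hρ).2.1
        have hρU := b1_subset_union_of_two_b1 hn h he hf hef heb heb' hfb hfb' he1 hfc hσ₁ hσ₂ hne hB1 hB2 hc1 hc2
          hρ hρB1
        rw [hσ₁eq, hσ₂eq] at hρU
        rcases pair_eq_of_subset_union_pair hρ2 hρU with h' | h' | h'
        · exact Or.inl (h'.trans hσ₁eq.symm)
        · exact Or.inr (Or.inl (h'.trans hσ₂eq.symm))
        · exact Or.inr (Or.inr h')
      by_cases hex : ∃ π ∈ d0Def N b b' e f, rk N (insert f π) = 2
      · obtain ⟨π, hπ, hπB2⟩ := hex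
        have hπ2 := (mem_d0Def.1 hπ).2.1
        by_cases hπB1 : rk N (insert e (((((gr N).erase b).erase b').erase f).erase e \ π)) = 3
        · have hsub : d0Def N b b' e f ⊆ {σ₁, σ₂, {x, x'}} := by
            intro ρ hρ
            have hρB1 : rk N (insert e (((((gr N).erase b).erase b').erase f).erase e \ ρ)) = 3 := by
              rcases hor ρ hρ with h' | h'
              · exact h'
              · rw [hB2one π hπ hπB2 ρ hρ h']; exact hπB1
            rcases htri ρ hρ hρB1 with h' | h' | h'
            · rw [h']; exact mem_insert_self _ _
            · rw [h']; exact mem_insert_of_mem (mem_insert_self _ _)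
            · rw [h']; exact mem_insert_of_mem (mem_insert_of_mem (mem_singleton_self _))
          exact (card_le_card hsub).trans card_le_three
        · by_cases hxx'D : ({x, x'} : Finset α) ∈ d0Def N b b' e f
          · by_cases hxx'B1 : rk N (insert e (((((gr N).erase b).erase b').erase f).erase e \ {x, x'})) = 3
            · -- `π` meets the three B1 edges of the triangle, so it is one of them: B1, against `hπB1`
              exfalso
              have hm : ∀ τ ∈ d0Def N b b' e f, ∃ u ∈ π, u ∈ τ := fun τ hτ => hmeet π hπ hπB2 τ hτ
              have hm1 : c ∈ π ∨ x ∈ π := by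
                obtain ⟨u, huπ, hu⟩ := hm σ₁ hσ₁
                rw [hσ₁eq] at hu
                simp only [mem_insert, mem_singleton] at hu
                rcases hu with rfl | rfl
                · exact Or.inl huπ
                · exact Or.inr huπ
              have hm2 : c ∈ π ∨ x' ∈ π := by
                obtain ⟨u, huπ, hu⟩ := hm σ₂ hσ₂
                rw [hσ₂eq] at hu
                simp only [mem_insert, mem_singleton] at hu
                rcases hu with rfl | rfl
                · exact Or.inl huπ
                · exact Or.inr huπ
              have hm3 : x ∈ π ∨ x' ∈ π := by
                obtain ⟨u, huπ, hu⟩ := hm _ hxx'D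
                simp only [mem_insert, mem_singleton] at hu
                rcases hu with rfl | rfl
                · exact Or.inl huπ
                · exact Or.inr huπ
              rcases pair_eq_of_meets_triangle hπ2 hxc.symm hx'c.symm hxx' hm1 hm2 hm3 with h' | h' | h'
              · rw [h', ← hσ₁eq] at hπB1; exact hπB1 hB1
              · rw [h', ← hσ₂eq] at hπB1; exact hπB1 hB2
              · rw [h'] at hπB1; exact hπB1 hxx'B1
            · -- `{x, x′}` is B2, hence `= π`; every defect is `σ₁`, `σ₂` or `π`
              have hxx'B2 := (hor _ hxx'D).resolve_left hxx'B1
              have hπeq : ({x, x'} : Finset α) = π := hB2one π hπ hπB2 _ hxx'D hxx'B2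
              have hsub : d0Def N b b' e f ⊆ {σ₁, σ₂, π} := by
                intro ρ hρ
                rcases hor ρ hρ with h' | h'
                · rcases htri ρ hρ h' with h'' | h'' | h''
                  · rw [h'']; exact mem_insert_self _ _
                  · rw [h'']; exact mem_insert_of_mem (mem_insert_self _ _)
                  · rw [h'', hπeq]; exact mem_insert_of_mem (mem_insert_of_mem (mem_singleton_self _))
                · rw [hB2one π hπ hπB2 ρ hρ h']
                  exact mem_insert_of_mem (mem_insert_of_mem (mem_singleton_self _))
              exact (card_le_card hsub).trans card_le_three
          · have hsub : d0Def N b b' e f ⊆ {σ₁, σ₂, π} := by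
              intro ρ hρ
              rcases hor ρ hρ with h' | h'
              · rcases htri ρ hρ h' with h'' | h'' | h''
                · rw [h'']; exact mem_insert_self _ _
                · rw [h'']; exact mem_insert_of_mem (mem_insert_self _ _)
                · exact absurd (h'' ▸ hρ) hxx'D
              · rw [hB2one π hπ hπB2 ρ hρ h']
                exact mem_insert_of_mem (mem_insert_of_mem (mem_singleton_self _))
            exact (card_le_card hsub).trans card_le_three
      · push Not at hex
        have hsub : d0Def N b b' e f ⊆ {σ₁, σ₂, {x, x'}} := by
          intro ρ hρ
          rcases htri ρ hρ ((hor ρ hρ).resolve_right (hex ρ hρ)) with h' | h' | h'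
          · rw [h']; exact mem_insert_self _ _
          · rw [h']; exact mem_insert_of_mem (mem_insert_self _ _)
          · rw [h']; exact mem_insert_of_mem (mem_insert_of_mem (mem_singleton_self _))
        exact (card_le_card hsub).trans card_le_three
    · push Not at h2B1
      -- the B1 defects are pairwise disjoint: at most two; the B2 defects: at most one
      have hB1c : ((d0Def N b b' e f).filter
          (fun π => rk N (insert e (((((gr N).erase b).erase b').erase f).erase e \ π)) = 3)).card ≤ 2 := by
        apply card_le_two_of_pairwise_disjoint_pairs hX5
        · intro π hπ
          have hπ' := mem_d0Def.1 (mem_filter.1 hπ).1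
          exact ⟨hπ'.1, hπ'.2.1⟩
        · intro π hπ σ hσ hne u hu huσ
          have hπ' := mem_filter.1 hπ
          have hσ' := mem_filter.1 hσ
          exact h2B1 u π hπ'.1 σ hσ'.1 hne hu huσ hπ'.2 hσ'.2
      have hB2c : ((d0Def N b b' e f).filter (fun π => rk N (insert f π) = 2)).card ≤ 1 := by
        apply card_le_one.2
        intro π hπ σ hσ
        have hπ' := mem_filter.1 hπ
        have hσ' := mem_filter.1 hσ
        exact (hB2one π hπ'.1 hπ'.2 σ hσ'.1 hσ'.2).symm
      have hsub : d0Def N b b' e f ⊆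
          (d0Def N b b' e f).filter
            (fun π => rk N (insert e (((((gr N).erase b).erase b').erase f).erase e \ π)) = 3) ∪
          (d0Def N b b' e f).filter (fun π => rk N (insert f π) = 2) := by
        intro ρ hρ
        rcases hor ρ hρ with h' | h'
        · exact mem_union_left _ (mem_filter.2 ⟨hρ, h'⟩)
        · exact mem_union_right _ (mem_filter.2 ⟨hρ, h'⟩)
      have h3 := card_le_card hsub
      have h4 := card_union_le ((d0Def N b b' e f).filter
        (fun π => rk N (insert e (((((gr N).erase b).erase b').erase f).erase e \ π)) = 3))
        ((d0Def N b b' e f).filter (fun π => rk N (insert f π) = 2))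
      omega

end StarSharpDefectE

end PercRepro.Cogirth
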